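import Literature.Analysis.FluidPDE.KNSSProp41MildHolds
import HarnessLib

/-!
# KNSS 2009, (4.6) read at the end of the smoothing window: `‖∇u(t)‖_∞ ≤ C ‖u‖²_{L^∞}` for
# bounded mild solutions, and the incompatibility of a fitted pair of blow-up laws with it

Analysis/FluidPDE corollary file (everything PROVED; no definitions, no named facts) of the
discharged fact `Literature.Analysis.FluidPDE.KNSS2009_prop41_mild`
(`KNSSMildRegularity.lean`, `KNSS2009_prop41_mild_holds` in `KNSSProp41MildHolds.lean`;
G. Koch, N. Nadirashvili, G. Seregin, V. Šverák, *Liouville theorems for the Navier–Stokes equations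
and applications*, Acta Math. 203 (2009) = arXiv:0709.3599v1, §4 p. 8, Proposition 4.1 with the
quantitative estimate (4.6): `‖t^{k/2}∇ᵏu‖_{L^∞(ℝⁿ × (0,T'))} ≤ C(k)‖u₀‖_{L^∞}` for
`T' = ε(k)‖u₀‖^{-2}_{L^∞}`).

Reading (4.6) with `k = 1` AT the end `t = T'` of the window gives the scale-invariant gradient
bound of "local regularity of bounded mild solutions" in the form in which blow-up bookkeeping uses
it (Koch–Nadirashvili–Seregin–Šverák 2009, §6; Seregin–Šverák 2009; the "`‖∇ᵏu(t)‖_∞ ≤ C_k M^{k+1}`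
if `|u| ≤ M` on `ℝ³ × [t − M⁻², t]`" of regularity folklore): **if a restarted bounded mild solution
is bounded by `N` on a window of length at least `ε/N²` ending after `t`, then
`‖∇u(t)‖ ≤ C N²`** — `exists_norm_iteratedFDeriv_one_le_sq` (and the `fderiv` spelling
`exists_norm_fderiv_le_sq`). In particular, at a "running-maximum time" `t` of a putative blow-up
(`‖u(t')‖_∞ ≤ ‖u(t)‖_∞ =: N` on `[t − ε N⁻², t]`) the ratio `‖∇u(t)‖_∞ / ‖u(t)‖²_∞` is bounded
by a universal constant; hence so is `‖ω(t)‖_∞ / ‖u(t)‖²_∞` (`|ω| ≤ 2|∇u|` pointwise).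

The second theorem is the elementary ARITHMETIC consequence for fitted blow-up laws: the pair of
linear fits printed by Hou for his axisymmetric Navier–Stokes computation — `‖u(t)‖_{L^∞} ∼
(T−t)^{−1/2}` and `‖ω(t)‖_{L^∞} ∼ |log(T−t)|/(T−t)` (T. Y. Hou, Found. Comput. Math. 23 (2022) =
arXiv:2107.06509, §3.4.1, the displays after Fig. "linear_regression_w1_nse" and
"linear_regression_vel_nse"; the author stresses "this linear fitting of the asymptotic growth rate
is qualitative in nature") — cannot BOTH be exact two-sided asymptotics along a sequence of
running-maximum times, since their ratio `‖ω‖_∞/‖u‖²_∞ ∼ |log(T−t)| → ∞` would violate the bound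
above (`not_jointFit_sqrtRate_logRate`: stated abstractly for two real functions `f, g` and a
sequence `tₙ → T⁻` carrying the three inequalities; no Navier–Stokes object appears in it). This
is bookkeeping on fits, not a statement about any solution; it does not assert or deny blow-up.

## References

* G. Koch, N. Nadirashvili, G. Seregin, V. Šverák, Acta Math. 203 (2009) 83–105 =
  arXiv:0709.3599v1, §4 p. 8, Prop. 4.1 with (4.6). [KochNadirashviliSereginSverak2009]
* T. Y. Hou, *Potentially singular behavior of the 3D Navier–Stokes equations*, Found. Comput.
  Math. 23 (2022) 2251–2299 = arXiv:2107.06509, §3.4.1 (fitted growth rates) and the Remark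
  closing §3.4 ("qualitative in nature"). [Hou2022PotentiallySingularNS]
-/

noncomputable section

open MeasureTheory Set Filter Topology

namespace Literature.Analysis.FluidPDE

/-! ### (4.6) at the end of the window -/

/-- **KNSS 2009, (4.6) with `k = 1` at the end of the smoothing window.** There are universal
`ε > 0` and `C ≥ 0` such that: if `V` is a restarted bounded mild solution of Navier–Stokes
(`ν = 1`) on `(0, T) × ℝ³` with bound `N` (`IsKNSSDriftMild T N V 0`), then at every time
`t ∈ (0, T)` with `N² t ≥ ε` — i.e. preceded inside the window by an interval of length `ε/N²` on
which `‖V‖ ≤ N` — the gradient obeys the scale-invariant bound `‖∇V(t, x)‖ ≤ C N²` for all `x`.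
(Print: `‖t^{1/2}∇u‖_{L^∞(ℝⁿ×(0,T'))} ≤ C(1)‖u₀‖_{L^∞}`, `T' = ε(1)‖u₀‖⁻²_{L^∞}`, read at
`t = T'/2` after restarting at `s = t − ε/(2N²)`: `‖∇u(t)‖ ≤ C(1) N (ε/(2N²))^{−1/2} =
C(1)√(2/ε) N²`.) Proved from `KNSS2009_prop41_mild` (hypothesis `h`; discharged in the tree as
`KNSS2009_prop41_mild_holds`). [cite: KochNadirashviliSereginSverak2009, Prop. 4.1 with (4.6), k = 1 (arXiv:0709.3599v1 p. 8)] -/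
theorem KNSS2009_prop41_mild.exists_norm_iteratedFDeriv_one_le_sq (h : KNSS2009_prop41_mild) :
    ∃ ε : ℝ, 0 < ε ∧ ∃ C : ℝ, 0 ≤ C ∧
      ∀ ⦃T N : ℝ⦄ ⦃V : ℝ → EuclideanSpace ℝ (Fin 3) → EuclideanSpace ℝ (Fin 3)⦄,
        IsKNSSDriftMild T N V 0 → ∀ t ∈ Ioo 0 T, ε ≤ N ^ 2 * t →
          ∀ x, ‖iteratedFDeriv ℝ 1 (V t) x‖ ≤ C * N ^ 2 := by
  obtain ⟨ε, hε, C, hC, H⟩ := h 1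
  refine ⟨ε, hε, C * Real.sqrt (2 / ε), by positivity, ?_⟩
  intro T N V hV t ht hNt x
  have hN0 : 0 ≤ N := hV.nonneg
  have hN2 : 0 < N ^ 2 := by
    rcases (sq_nonneg N).eq_or_lt with h0 | h0
    · exfalso
      rw [← h0, zero_mul] at hNt
      exact absurd hNt (not_le.2 hε)
    · exact h0
  have hNpos : 0 < N := by
    rcases hN0.eq_or_lt with h0 | h0
    · exfalso; rw [← h0] at hN2; simp at hN2
    · exact h0
  -- restart at `s = t − ε/(2N²)`
  set a : ℝ := ε / (2 * N ^ 2) with ha_def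
  have ha : 0 < a := by positivity
  have hat : a ≤ t / 2 := by
    have h' : ε / N ^ 2 ≤ t := by
      rw [div_le_iff₀ hN2]
      linarith [hNt]
    have : a = ε / N ^ 2 / 2 := by rw [ha_def]; ring
    rw [this]
    linarith
  set s : ℝ := t - a with hs_def
  have hts : t - s = a := by rw [hs_def]; ring
  have hs0 : 0 < s := by rw [hs_def]; linarith [ht.1]
  have hst : s < t := by rw [hs_def]; linarith
  have hwin : N ^ 2 * (t - s) < ε := by
    rw [hts, ha_def]
    field_simp
    linarith
  obtain ⟨h1, -⟩ := (H hV).2 s ⟨hs0, hst.trans ht.2⟩ t ⟨hst, ht.2⟩ hwin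
  have key : (t - s) ^ ((1 : ℝ) / 2) * ‖iteratedFDeriv ℝ 1 (V t) x‖ ≤ C * N := by
    simpa using h1 x
  rw [hts] at key
  -- `a^{1/2} = √a` and `√(2/ε) · N · √a = 1`
  have hsqrt : a ^ ((1 : ℝ) / 2) = Real.sqrt a := by rw [Real.sqrt_eq_rpow]
  rw [hsqrt] at key
  have hprod : Real.sqrt (2 / ε) * Real.sqrt a = 1 / N := by
    rw [← Real.sqrt_mul (by positivity) a, ha_def]
    have : (2 / ε) * (ε / (2 * N ^ 2)) = (1 / N) ^ 2 := by
      field_simp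
    rw [this, Real.sqrt_sq (by positivity)]
  have hone : (C * Real.sqrt (2 / ε) * N ^ 2) * Real.sqrt a = C * N := by
    calc (C * Real.sqrt (2 / ε) * N ^ 2) * Real.sqrt a
        = C * N ^ 2 * (Real.sqrt (2 / ε) * Real.sqrt a) := by ring
      _ = C * N ^ 2 * (1 / N) := by rw [hprod]
      _ = C * N := by field_simp
  have hsa : 0 < Real.sqrt a := Real.sqrt_pos.2 ha
  -- cancel `√a > 0`
  have key' : Real.sqrt a * ‖iteratedFDeriv ℝ 1 (V t) x‖ ≤
      Real.sqrt a * (C * Real.sqrt (2 / ε) * N ^ 2) := by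
    rw [mul_comm (Real.sqrt a) (C * Real.sqrt (2 / ε) * N ^ 2), hone]
    exact key
  exact le_of_mul_le_mul_left key' hsa

/-- `‖Df(x)‖ = ‖D¹f(x)‖` (Mathlib's `norm_iteratedFDeriv_fderiv` with `n = 0` and
`norm_iteratedFDeriv_zero`). [folklore] -/
private theorem norm_fderiv_eq_norm_iteratedFDeriv_one_aux
    (f : EuclideanSpace ℝ (Fin 3) → EuclideanSpace ℝ (Fin 3)) (x : EuclideanSpace ℝ (Fin 3)) :
    ‖fderiv ℝ f x‖ = ‖iteratedFDeriv ℝ 1 f x‖ := by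
  rw [← norm_iteratedFDeriv_fderiv, norm_iteratedFDeriv_zero]

/-- **KNSS 2009, (4.6) with `k = 1` at the end of the smoothing window, `fderiv` spelling**: as
`KNSS2009_prop41_mild.exists_norm_iteratedFDeriv_one_le_sq`, with the conclusion
`‖fderiv ℝ (V t) x‖ ≤ C N²`. [cite: KochNadirashviliSereginSverak2009, Prop. 4.1 with (4.6), k = 1 (arXiv:0709.3599v1 p. 8)] -/
theorem KNSS2009_prop41_mild.exists_norm_fderiv_le_sq (h : KNSS2009_prop41_mild) :
    ∃ ε : ℝ, 0 < ε ∧ ∃ C : ℝ, 0 ≤ C ∧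
      ∀ ⦃T N : ℝ⦄ ⦃V : ℝ → EuclideanSpace ℝ (Fin 3) → EuclideanSpace ℝ (Fin 3)⦄,
        IsKNSSDriftMild T N V 0 → ∀ t ∈ Ioo 0 T, ε ≤ N ^ 2 * t →
          ∀ x, ‖fderiv ℝ (V t) x‖ ≤ C * N ^ 2 := by
  obtain ⟨ε, hε, C, hC, H⟩ := h.exists_norm_iteratedFDeriv_one_le_sq
  refine ⟨ε, hε, C, hC, fun T N V hV t ht hNt x => ?_⟩
  rw [norm_fderiv_eq_norm_iteratedFDeriv_one_aux]
  exact H hV t ht hNt x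

/-- **KNSS 2009, (4.6) at the end of the window — unconditional** (the fact is discharged in the
tree: `KNSS2009_prop41_mild_holds`): universal `ε > 0`, `C ≥ 0` with `‖∇V(t, x)‖ ≤ C N²` for
every restarted bounded mild solution with bound `N` on `(0, T)` and every `t ∈ (0, T)` with
`N² t ≥ ε`. [cite: KochNadirashviliSereginSverak2009, Prop. 4.1 with (4.6), k = 1 (arXiv:0709.3599v1 p. 8)] -/
theorem exists_norm_fderiv_le_sq_of_isKNSSDriftMild :
    ∃ ε : ℝ, 0 < ε ∧ ∃ C : ℝ, 0 ≤ C ∧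
      ∀ ⦃T N : ℝ⦄ ⦃V : ℝ → EuclideanSpace ℝ (Fin 3) → EuclideanSpace ℝ (Fin 3)⦄,
        IsKNSSDriftMild T N V 0 → ∀ t ∈ Ioo 0 T, ε ≤ N ^ 2 * t →
          ∀ x, ‖fderiv ℝ (V t) x‖ ≤ C * N ^ 2 :=
  KNSS2009_prop41_mild_holds.exists_norm_fderiv_le_sq

/-! ### Arithmetic: a fitted pair of laws incompatible with the window-end bound -/

/-- **The fitted pair `‖u‖_∞ ∼ (T−t)^{−1/2}`, `‖ω‖_∞ ∼ |log(T−t)|/(T−t)` is incompatible, as a pair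
of exact two-sided asymptotics, with the window-end bound** (arithmetic remark on the two linear
fits printed in Hou, Found. Comput. Math. 23 (2022) = arXiv:2107.06509, §3.4.1:
"`‖ω⃗(t)‖_{L^∞} ∼ |log(T−t)|/(T−t)`" and "`‖𝐮(t)‖_{L^∞} ∼ 1/(T−t)^{1/2}`", which the author calls
"qualitative in nature"; the bound is (4.6) of Koch–Nadirashvili–Seregin–Šverák 2009 read at the
end of the window, `exists_norm_fderiv_le_sq_of_isKNSSDriftMild`, giving `g ≤ K f²` at
running-maximum times). **Statement** (pure real analysis; `f`, `g` stand for `t ↦ ‖u(t)‖_∞`,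
`t ↦ ‖ω(t)‖_∞`): there are no constants `A`, `B, K > 0` and no sequence `tₙ → T` with `tₙ < T` along
which simultaneously `f(tₙ)² ≤ A/(T − tₙ)` (the upper half of the velocity fit),
`B |log(T − tₙ)|/(T − tₙ) ≤ g(tₙ)` (the lower half of the vorticity fit) and `g(tₙ) ≤ K f(tₙ)²`
(the window-end bound at running-maximum times). Indeed the three give `B|log(T−tₙ)| ≤ K A`, while
`|log(T−tₙ)| → ∞`. Nothing here refers to a solution of any equation. [cite: Hou2022PotentiallySingularNS, §3.4.1 (the two fitted laws); KochNadirashviliSereginSverak2009, (4.6)] -/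
theorem not_jointFit_sqrtRate_logRate {T A B K : ℝ} (hB : 0 < B) (hK : 0 < K)
    {f g : ℝ → ℝ} {s : ℕ → ℝ} (hsT : ∀ n, s n < T) (hs : Tendsto s atTop (𝓝 T))
    (hf : ∀ n, f (s n) ^ 2 ≤ A / (T - s n))
    (hg : ∀ n, B * |Real.log (T - s n)| / (T - s n) ≤ g (s n))
    (hloc : ∀ n, g (s n) ≤ K * f (s n) ^ 2) : False := by
  -- along the sequence, `B |log(T − sₙ)| ≤ K A`
  have hbound : ∀ n, B * |Real.log (T - s n)| ≤ K * A := by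
    intro n
    have hd : 0 < T - s n := sub_pos.2 (hsT n)
    have h1 : B * |Real.log (T - s n)| / (T - s n) ≤ K * (A / (T - s n)) :=
      (hg n).trans ((hloc n).trans (mul_le_mul_of_nonneg_left (hf n) hK.le))
    rw [← mul_div_assoc, div_le_div_iff_of_pos_right hd] at h1
    exact h1
  -- but `T − sₙ → 0⁺`, so `|log(T − sₙ)| → ∞`
  have hd : Tendsto (fun n => T - s n) atTop (𝓝[>] 0) := by
    refine tendsto_nhdsWithin_iff.2 ⟨?_, Eventually.of_forall fun n => sub_pos.2 (hsT n)⟩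
    have : Tendsto (fun n => T - s n) atTop (𝓝 (T - T)) := tendsto_const_nhds.sub hs
    simpa using this
  have hlog : Tendsto (fun n => Real.log (T - s n)) atTop atBot :=
    Real.tendsto_log_nhdsGT_zero.comp hd
  have habs : Tendsto (fun n => |Real.log (T - s n)|) atTop atTop :=
    tendsto_abs_atBot_atTop.comp hlog
  have hev := habs.eventually_gt_atTop (K * A / B)
  obtain ⟨n, hn⟩ := hev.exists
  have : K * A < B * |Real.log (T - s n)| := by
    rw [div_lt_iff₀ hB] at hn
    linarith
  exact absurd (hbound n) (not_le.2 this)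

end Literature.Analysis.FluidPDE
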